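import Summits.Parity.BatemanHorn.Theses.RoughValueTransport
import Summits.Parity.BatemanHorn.Theorems.RoughValueTransportRoughValueLawOmegaFacts
import Literature.NumberTheory.Sieve.RoughNumbersClassesEquidistribution
import Literature.NumberTheory.Sieve.LinearPolynomialRoughValuesClasses
import Literature.NumberTheory.Sieve.AletheiaZomleferFukshanskyGarcia2020Applications
import Literature.Barriers.Parity.UniformBatemanHornBunyakovsky
import HarnessLib

/-!
# Route `RoughValueTransport`, crux `RoughValueLaw` (stmt-Parity-11390), line `increment-anchoring`:
# the registered stub `stub_linearRoughValueLaw`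

`--supports` file of the checked skeleton
`Summits/Parity/BatemanHorn/Cruxes/RoughValueLaw/Lines/increment-anchoring.lean`
(crux `Summit.Parity.BatemanHorn.Theses.RoughValueTransport.RoughValueLaw`).  It PROVES the
registered stub `stub_linearRoughValueLaw`, verbatim: for `k = 1` and a LINEAR Bateman–Horn
polynomial `f₀ = aX + b` (`a ≥ 1`; no prime divides `a` and `b`), every inline-Buchstab `ω` and every
`u > 2`,
`Φ_f(x, u) (log x)/x → (C(f)/∏ deg fᵢ) · u ω(u)`, where
`Φ_f(x, u) = #{1 ≤ n ≤ x : a n + b > 0 and no prime p < x^{1/u} divides a n + b}` and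
`C(f) = a/φ(a)` is the Bateman–Horn constant of `aX + b`.  Everything used is PROVED in the tree;
no definition and no new fact is introduced.

## The argument (sub-namespace `LinearRoughValueLaw`)

1. (`LinearRoughValues.abs_card_sub_card_filter_le`, `LinearPolynomialRoughValuesClasses.lean`)
   `n ↦ a n + b` identifies `Φ_f(x, u)` with the count `Φ(X, z; a, b) = #{m ≤ X : m ≡ b (a), P⁻(m) ≥ z}`
   of `z`-rough numbers in the class `b mod a`, `X = a x + b`, `z = x^{1/u}`, up to `O(1)`.
2. (`RoughAP.exists_forall_abs_card_filter_sub_buchstab_le`,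
   `RoughNumbersClassesEquidistribution.lean`) Buchstab–de Bruijn in a reduced class:
   `Φ(X, z; a, b) = ω_B(log X/log z) X/(φ(a) log z) + o(X/log z)` — rough numbers are
   equidistributed among the reduced classes (Buchstab's identity for class counts, induction from
   the PROVED prime number theorem in arithmetic progressions) and the PROVED integer law
   `Φ(X, z) = ω_B(u) X/log z + O(X/log² z)` (Lichtman's Lemma 6.1,
   `exists_abs_card_roughIcc_sub_buchstab_le`); here `ω_B = buchstabOmega`.
3. (`tendsto_card_filter_linear`) `log X/log z → u`, `ω_B` is continuous at `u`
   (`continuousAt_buchstabOmega`), `(X/log z)(log x/x) → a u`: the normalised count tends to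
   `(a/φ(a)) u ω_B(u)`.
4. (`const_of_linear`) `C(f) = a/φ(a)`: translate `f₀` to `aX + b'` with `b' ≥ 0`
   (`Literature.Barriers.Parity.hasBatemanHornConst_comp_X_add_C_iff`), `(a, b') = 1` from
   `hasNoFixedPrimeDivisor`, and `hasBatemanHornConst_linear`; finally `ω = ω_B` on `[1, ∞)`
   (`OmegaFacts.eq_buchstabOmega`, the landed uniqueness of Buchstab's function) and
   `∏_{i : Fin 1} deg fᵢ = 1`.

References: G. Tenenbaum, *Introduction to analytic and probabilistic number theory*, Ch. III.6;
A. A. Buchstab (1937); the line card `Cruxes/RoughValueLaw/Lines/increment-anchoring.md`.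
-/

noncomputable section

open Filter Finset Polynomial
open scoped Topology BigOperators
open Literature.NumberTheory.Sieve

namespace Summit.Parity.BatemanHorn.Cruxes.RoughValueLaw.IncrementAnchoring

namespace LinearRoughValueLaw

/-- **The Bateman–Horn data of a linear system.** For a Bateman–Horn system `f = (f₀)` with
`deg f₀ = 1`, write `f₀ = αX + β` (`α = ` leading coefficient): then `α ≥ 1`, the class `β mod α`
is prime to `α`, and `C(f) = α/φ(α)` (translate to `αX + b'` with `b' = α|β| + β ≥ 0`; a common
prime factor `p` of `α, b'` would give `ω_f(p) = p`; `hasBatemanHornConst_linear`). [folklore] -/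
theorem const_of_linear {f : Fin 1 → ℤ[X]} (hf : IsBatemanHornSystem f)
    (hdeg : (f 0).natDegree = 1) :
    0 < (f 0).coeff 1 ∧
      (((f 0).coeff 0 % (f 0).coeff 1).toNat).Coprime ((f 0).coeff 1).toNat ∧
      batemanHornConst f = ((f 0).coeff 1 : ℝ) / ((((f 0).coeff 1).toNat).totient : ℝ) := by
  set g := f 0 with hg_def
  set α : ℤ := g.coeff 1 with hα_def
  set β : ℤ := g.coeff 0 with hβ_def
  have hα : 0 < α := by
    have h := hf.leadingCoeff_pos 0
    rwa [← coeff_natDegree, ← hg_def, hdeg] at h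
  have hg : g = C α * X + C β := eq_X_add_C_of_natDegree_le_one hdeg.le
  have hf1 : f = ![g] := by funext i; fin_cases i; rfl
  set a : ℕ := α.toNat with ha_def
  have haα : (a : ℤ) = α := Int.toNat_of_nonneg hα.le
  have ha0 : 0 < a := by omega
  set t : ℤ := |β| with ht_def
  have hb'0 : 0 ≤ α * t + β := by
    have h1 : -β ≤ t := neg_le_abs β
    have h2 : 0 ≤ t := abs_nonneg β
    nlinarith
  set b' : ℕ := (α * t + β).toNat with hb'_def
  have hb'Z : (b' : ℤ) = α * t + β := Int.toNat_of_nonneg hb'0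
  -- the translate `g(X + t) = aX + b'`
  have hcomp : g.comp (X + C t) = C (a : ℤ) * X + C (b' : ℤ) := by
    rw [hg, haα, hb'Z]
    simp only [add_comp, mul_comp, C_comp, X_comp, map_add, map_mul]
    ring
  -- `(a, b') = 1` from `hasNoFixedPrimeDivisor`
  have hab : a.Coprime b' := by
    refine Nat.coprime_of_dvd fun p hp hpa hpb => ?_
    have hlt := hf.hasNoFixedPrimeDivisor p hp
    have hcount : polyRootCountMod f p = p := by
      rw [hf1, ← Literature.Barriers.Parity.polyRootCountMod_comp_X_add_C g t p, hcomp]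
      unfold polyRootCountMod
      rw [filter_true_of_mem, card_range]
      intro n _
      simp only [Fin.prod_univ_one, Matrix.cons_val_fin_one, eval_add, eval_mul, eval_C, eval_X]
      exact dvd_add (dvd_mul_of_dvd_left (Int.natCast_dvd_natCast.mpr hpa) _)
        (Int.natCast_dvd_natCast.mpr hpb)
    rw [hcount] at hlt
    exact lt_irrefl p hlt
  -- the class `β mod α` is `b' mod a`
  have hclass : (β % α).toNat = b' % a := by
    have h1 : ((b' % a : ℕ) : ℤ) = β % α := by
      rw [Int.natCast_mod, haα, hb'Z, add_comm, Int.add_mul_emod_self_left]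
    have h2 : 0 ≤ β % α := Int.emod_nonneg β hα.ne'
    omega
  refine ⟨hα, ?_, ?_⟩
  · rw [hclass]
    exact (RoughAP.coprime_mod_iff b').mpr hab.symm
  · have hC : HasBatemanHornConst f ((a : ℝ) / (a.totient : ℝ)) := by
      rw [hf1, ← Literature.Barriers.Parity.hasBatemanHornConst_comp_X_add_C_iff g t, hcomp]
      exact hasBatemanHornConst_linear a b' ha0 hab
    rw [hC.batemanHornConst_eq]
    have : (α : ℝ) = (a : ℝ) := by exact_mod_cast haα.symm
    rw [this]

/-- **The analytic core: Buchstab–de Bruijn for the rough values of `αn + β`.** For integers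
`α ≥ 1`, `β` with the class `β mod α` prime to `α`, and `u > 2`,
`#{1 ≤ n ≤ x : α n + β > 0, p < x^{1/u} prime ⇒ p ∤ α n + β} · (log x)/x → (α/φ(α)) u ω_B(u)`:
the count is `Φ(αx + β, x^{1/u}; α, β) + O(1)` (`LinearRoughValues.abs_card_sub_card_filter_le`),
`Φ(X, z; α, β) = ω_B(log X/log z) X/(φ(α) log z) + o(X/log z)`
(`RoughAP.exists_forall_abs_card_filter_sub_buchstab_le` with `U = u + 1`), `log X/log z → u`,
`ω_B` is continuous at `u` and `(X/log z)(log x/x) → α u`. [folklore] -/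
theorem tendsto_card_filter_linear {α β : ℤ} (hα : 0 < α)
    (hcop : ((β % α).toNat).Coprime α.toNat) {u : ℝ} (hu : 2 < u) :
    Tendsto (fun x : ℕ => (#((Icc 1 x).filter (fun n : ℕ => 0 < α * n + β ∧
        ∀ p ∈ range ⌈(x : ℝ) ^ (1 / u)⌉₊, p.Prime → ¬ ((p : ℤ) ∣ α * n + β))) : ℝ) *
          Real.log x / x) atTop
      (𝓝 ((α : ℝ) / (((α.toNat).totient : ℕ) : ℝ) * (u * buchstabOmega u))) := by
  set a : ℕ := α.toNat with ha_def
  have haα : (a : ℤ) = α := Int.toNat_of_nonneg hα.le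
  have ha0 : 0 < a := by omega
  have hαR1 : (1 : ℝ) ≤ (α : ℝ) := by exact_mod_cast hα
  have hαa : (α : ℝ) = (a : ℝ) := by exact_mod_cast haα.symm
  set c : ℕ := (β % α).toNat with hc_def
  set φ : ℝ := ((a.totient : ℕ) : ℝ) with hφ_def
  have hφ0 : 0 < φ := by rw [hφ_def]; exact_mod_cast Nat.totient_pos.mpr ha0
  have hu0 : 0 < u := by linarith
  have hu1 : 1 < u := by linarith
  -- the functions `z = x^{1/u}`, `X = αx + β`, the count, the class count and the main term
  obtain ⟨z, hz⟩ : ∃ z : ℕ → ℝ, ∀ x, z x = (x : ℝ) ^ (1 / u) := ⟨_, fun _ => rfl⟩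
  obtain ⟨Xr, hXr⟩ : ∃ X : ℕ → ℝ, ∀ x, X x = (α : ℝ) * x + β := ⟨_, fun _ => rfl⟩
  obtain ⟨cnt, hcnt⟩ : ∃ g : ℕ → ℝ, ∀ x, g x = (#((Icc 1 x).filter (fun n : ℕ => 0 < α * n + β ∧
      ∀ p ∈ range ⌈(x : ℝ) ^ (1 / u)⌉₊, p.Prime → ¬ ((p : ℤ) ∣ α * n + β))) : ℝ) :=
    ⟨_, fun _ => rfl⟩
  obtain ⟨Φc, hΦc⟩ : ∃ g : ℕ → ℝ, ∀ x,
      g x = (#((roughIcc ⌈z x⌉₊ ⌊Xr x⌋₊).filter (· ≡ c [MOD a])) : ℝ) := ⟨_, fun _ => rfl⟩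
  obtain ⟨Mn, hMn⟩ : ∃ g : ℕ → ℝ, ∀ x, g x =
      buchstabOmega (Real.log (Xr x) / Real.log (z x)) * Xr x / (a.totient * Real.log (z x)) :=
    ⟨_, fun _ => rfl⟩
  have hz_tend : Tendsto z atTop atTop := by
    have h := (tendsto_rpow_atTop (by positivity : (0 : ℝ) < 1 / u)).comp
      tendsto_natCast_atTop_atTop
    exact h.congr fun x => (hz x).symm
  have hXr_tend : Tendsto Xr atTop atTop := by
    have h := tendsto_atTop_add_const_right atTop (β : ℝ)
      ((tendsto_natCast_atTop_atTop (R := ℝ)).const_mul_atTop (by positivity : (0 : ℝ) < α))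
    exact h.congr fun x => (hXr x).symm
  have hαβ : Tendsto (fun x : ℕ => (α : ℝ) + β / x) atTop (𝓝 (α : ℝ)) := by
    have h : Tendsto (fun x : ℕ => (α : ℝ) + β / x) atTop (𝓝 ((α : ℝ) + 0)) :=
      tendsto_const_nhds.add (tendsto_const_nhds.div_atTop tendsto_natCast_atTop_atTop)
    rwa [add_zero] at h
  -- Term 1: the `O(1)` discrepancy between the count and the class count
  have h1 : Tendsto (fun x : ℕ => Real.log x / (x : ℝ) * (cnt x - Φc x)) atTop (𝓝 0) := by
    have hlog : Tendsto (fun x : ℕ => Real.log x / (x : ℝ)) atTop (𝓝 0) := by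
      have h := (Real.tendsto_pow_log_div_mul_add_atTop 1 0 1 one_ne_zero).comp
        tendsto_natCast_atTop_atTop
      refine h.congr fun x => ?_
      simp
    refine hlog.zero_mul_isBoundedUnder_le (Filter.isBoundedUnder_of ⟨((α + β).toNat : ℝ), ?_⟩)
    intro x
    rw [Function.comp_apply, Real.norm_eq_abs, hcnt, hΦc, hz, hXr]
    exact LinearRoughValues.abs_card_sub_card_filter_le α β hα _ x
  -- Term 2: the class count against the main term (`o(X/log z)`)
  have h2 : Tendsto (fun x : ℕ => (Φc x - Mn x) * (Real.log x / x)) atTop (𝓝 0) := by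
    refine Metric.tendsto_nhds.mpr fun ε hε => ?_
    have hε' : 0 < ε / (2 * u * ((α : ℝ) + 1)) := by positivity
    obtain ⟨X₀, hX₀⟩ := RoughAP.exists_forall_abs_card_filter_sub_buchstab_le ha0 (u + 1) hε'
    filter_upwards [hXr_tend.eventually_ge_atTop X₀,
      hz_tend.eventually_ge_atTop (max ((a : ℝ) + 2) ((2 : ℝ) ^ (1 / (u - 2)))),
      tendsto_natCast_atTop_atTop.eventually_ge_atTop (2 * |(β : ℝ)| + 2)] with x hx1 hx2 hx3
    have hβabs := abs_nonneg (β : ℝ)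
    have hβle := le_abs_self (β : ℝ)
    have hβge := neg_abs_le (β : ℝ)
    have hx0 : (0 : ℝ) < x := by linarith
    have hx1' : (1 : ℝ) < x := by linarith
    have hlogx : 0 < Real.log x := Real.log_pos hx1'
    have ha0R : (0 : ℝ) ≤ a := Nat.cast_nonneg a
    have hza : (a : ℝ) + 2 ≤ z x := le_trans (le_max_left _ _) hx2
    have hz2 : (2 : ℝ) ≤ z x := by linarith
    have hz0 : 0 < z x := by linarith
    have hqz : (a : ℝ) < z x := by linarith
    have hzu : z x ^ u = x := by
      rw [hz, ← Real.rpow_mul hx0.le, one_div_mul_cancel hu0.ne', Real.rpow_one]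
    have hzpow : (2 : ℝ) ≤ z x ^ (u - 2) := by
      have h1 : (2 : ℝ) ^ (1 / (u - 2)) ≤ z x := le_trans (le_max_right _ _) hx2
      have h2 := Real.rpow_le_rpow (by positivity) h1 (by linarith : (0 : ℝ) ≤ u - 2)
      rwa [← Real.rpow_mul (by norm_num : (0 : ℝ) ≤ 2),
        one_div_mul_cancel (by linarith : u - 2 ≠ 0), Real.rpow_one] at h2
    have hXx : (x : ℝ) ≤ 2 * Xr x := by
      rw [hXr]
      have : (x : ℝ) ≤ (α : ℝ) * x := by nlinarith
      linarith
    have hzsq : z x ^ 2 ≤ Xr x := by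
      have e : (x : ℝ) = z x ^ 2 * z x ^ (u - 2) := by
        rw [← Real.rpow_two, ← Real.rpow_add hz0, show (2 : ℝ) + (u - 2) = u by ring, hzu]
      have h0 : 0 ≤ z x ^ 2 := sq_nonneg _
      nlinarith
    have hXzu : Xr x ≤ z x ^ (u + 1) := by
      rw [Real.rpow_add hz0, hzu, Real.rpow_one, hXr]
      have : (x : ℝ) * ((a : ℝ) + 2) ≤ x * z x := mul_le_mul_of_nonneg_left hza hx0.le
      rw [← hαa] at this
      nlinarith
    have hmain := hX₀ (Xr x) (z x) hx1 hz2 hqz hzsq hXzu c hcop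
    rw [← hΦc x, ← hMn x] at hmain
    rw [Real.dist_eq, sub_zero]
    have hlz : Real.log (z x) = 1 / u * Real.log x := by rw [hz, Real.log_rpow hx0]
    have hXrx : Xr x ≤ ((α : ℝ) + 1) * x := by rw [hXr]; nlinarith
    have hdiv : Xr x / x ≤ (α : ℝ) + 1 := by rw [div_le_iff₀ hx0]; exact hXrx
    calc |(Φc x - Mn x) * (Real.log x / x)| = |Φc x - Mn x| * (Real.log x / x) := by
          rw [abs_mul, abs_of_nonneg (show (0 : ℝ) ≤ Real.log x / x by positivity)]
      _ ≤ ε / (2 * u * ((α : ℝ) + 1)) * Xr x / Real.log (z x) * (Real.log x / x) := by gcongr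
      _ = ε / (2 * u * ((α : ℝ) + 1)) * u * (Xr x / x) := by rw [hlz]; field_simp
      _ ≤ ε / (2 * u * ((α : ℝ) + 1)) * u * ((α : ℝ) + 1) := by gcongr
      _ = ε / 2 := by field_simp
      _ < ε := by linarith
  -- Term 3: the main term, `log X/log z → u` and continuity of `ω_B`
  have h3 : Tendsto (fun x : ℕ => Mn x * (Real.log x / x)) atTop
      (𝓝 ((α : ℝ) / φ * (u * buchstabOmega u))) := by
    have hr : Tendsto (fun x : ℕ => Real.log (Xr x) / Real.log (z x)) atTop (𝓝 u) := by
      have hlogαβ : Tendsto (fun x : ℕ => Real.log ((α : ℝ) + β / x)) atTop (𝓝 (Real.log α)) :=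
        hαβ.log (by positivity)
      have hinv : Tendsto (fun x : ℕ => (Real.log x)⁻¹) atTop (𝓝 0) :=
        tendsto_inv_atTop_zero.comp (Real.tendsto_log_atTop.comp tendsto_natCast_atTop_atTop)
      have hprod : Tendsto (fun x : ℕ => u * (1 + Real.log ((α : ℝ) + β / x) * (Real.log x)⁻¹))
          atTop (𝓝 (u * (1 + Real.log α * 0))) :=
        tendsto_const_nhds.mul (tendsto_const_nhds.add (hlogαβ.mul hinv))
      rw [mul_zero, add_zero, mul_one] at hprod
      refine hprod.congr' ?_
      filter_upwards [tendsto_natCast_atTop_atTop.eventually_ge_atTop (|(β : ℝ)| + 2)] with x hx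
      have hβge := neg_abs_le (β : ℝ)
      have hx0 : (0 : ℝ) < x := by linarith [abs_nonneg (β : ℝ)]
      have hx1' : (1 : ℝ) < x := by linarith [abs_nonneg (β : ℝ)]
      have hlogx : Real.log x ≠ 0 := (Real.log_pos hx1').ne'
      have hnum : 0 < (α : ℝ) * x + β := by nlinarith
      have hpos : 0 < (α : ℝ) + β / x := by
        have e : (α : ℝ) + β / x = ((α : ℝ) * x + β) / x := by field_simp
        rw [e]; positivity
      rw [hXr, hz, Real.log_rpow hx0]
      have e : (α : ℝ) * x + β = x * ((α : ℝ) + β / x) := by field_simp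
      rw [e, Real.log_mul hx0.ne' hpos.ne']
      field_simp
    have hω : Tendsto (fun x : ℕ => buchstabOmega (Real.log (Xr x) / Real.log (z x))) atTop
        (𝓝 (buchstabOmega u)) := (continuousAt_buchstabOmega hu1).tendsto.comp hr
    have hrest : Tendsto (fun x : ℕ => u * ((α : ℝ) + β / x) / φ) atTop (𝓝 (u * (α : ℝ) / φ)) :=
      (tendsto_const_nhds.mul hαβ).div_const φ
    have hall := hω.mul hrest
    have e : buchstabOmega u * (u * (α : ℝ) / φ) = (α : ℝ) / φ * (u * buchstabOmega u) := by ring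
    rw [e] at hall
    refine hall.congr' ?_
    filter_upwards [tendsto_natCast_atTop_atTop.eventually_ge_atTop (2 : ℝ)] with x hx
    have hx0 : (0 : ℝ) < x := by linarith
    have hlogx : Real.log x ≠ 0 := (Real.log_pos (by linarith)).ne'
    rw [hMn, hXr, hz, Real.log_rpow hx0, hφ_def]
    field_simp
  -- assembly
  have hsum := (h1.add h2).add h3
  rw [zero_add, zero_add] at hsum
  refine hsum.congr fun x => ?_
  rw [hcnt x]
  ring

end LinearRoughValueLaw

/-- **S0 — `stub_linearRoughValueLaw` (the linear sector of the crux `RoughValueLaw`).**  For a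
single LINEAR Bateman–Horn polynomial `f₀ = aX + b` (`k = 1`, `deg f₀ = 1`; `a ≥ 1`, no prime
divides `a` and `b`) and every inline-Buchstab `ω`, every rung of the crux holds with the FORCED
constant `A = C(f)/∏ deg = a/φ(a)`: `Φ_f(x, u) (log x)/x → C(f) u ω(u)` for every `u > 2`.  This is
Buchstab–de Bruijn in the arithmetic progression `b mod a` (rough numbers are equidistributed among
the reduced classes): `LinearRoughValueLaw.tendsto_card_filter_linear` (dictionary
`LinearRoughValues.abs_card_sub_card_filter_le`, class law
`RoughAP.exists_forall_abs_card_filter_sub_buchstab_le` from the PROVED prime number theorem in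
arithmetic progressions and the PROVED integer law `exists_abs_card_roughIcc_sub_buchstab_le`),
`C(f) = a/φ(a)` (`LinearRoughValueLaw.const_of_linear`) and `ω = ω_B` on `[1, ∞)`
(`OmegaFacts.eq_buchstabOmega`). [folklore] -/
theorem stub_linearRoughValueLaw :
    ∀ (k : ℕ) (f : Fin k → Polynomial ℤ), IsBatemanHornSystem f → k = 1 →
      (∀ i, (f i).natDegree = 1) → ∀ ω : ℝ → ℝ,
      ((∀ u : ℝ, 1 ≤ u → u ≤ 2 → ω u = u⁻¹) ∧ ContinuousOn ω (Set.Ici 1) ∧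
        (∀ u : ℝ, 2 < u → HasDerivAt (fun t : ℝ => t * ω t) (ω (u - 1)) u)) →
      ∀ u : ℝ, 2 < u →
        Tendsto (fun x : ℕ =>
          (((Icc 1 x).filter (fun n : ℕ => ∀ i, 0 < (f i).eval (n : ℤ) ∧
              ∀ p ∈ range ⌈(x : ℝ) ^ (((f i).natDegree : ℝ) / u)⌉₊,
                p.Prime → ¬ ((p : ℤ) ∣ (f i).eval (n : ℤ)))).card : ℝ) * Real.log x ^ k / (x : ℝ))
          atTop (𝓝 (batemanHornConst f / (∏ i, ((f i).natDegree : ℝ)) * (u * ω u) ^ k)) := by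
  intro k f hf hk hdeg ω hω u hu
  subst hk
  obtain ⟨hα, hcop, hconst⟩ := LinearRoughValueLaw.const_of_linear hf (hdeg 0)
  have hωu : ω u = buchstabOmega u := OmegaFacts.eq_buchstabOmega hω.1 hω.2.1 hω.2.2 (by linarith)
  have hprod : (∏ i : Fin 1, ((f i).natDegree : ℝ)) = 1 := by
    rw [Fin.prod_univ_one, hdeg 0, Nat.cast_one]
  rw [hprod, div_one, pow_one, hωu, hconst]
  have hg : ∀ n : ℕ, (f 0).eval (n : ℤ) = (f 0).coeff 1 * n + (f 0).coeff 0 := fun n => by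
    conv_lhs => rw [eq_X_add_C_of_natDegree_le_one (hdeg 0).le]
    simp only [eval_add, eval_mul, eval_C, eval_X]
  refine (LinearRoughValueLaw.tendsto_card_filter_linear hα hcop hu).congr fun x => ?_
  have hset : (Icc 1 x).filter (fun n : ℕ => 0 < (f 0).coeff 1 * n + (f 0).coeff 0 ∧
      ∀ p ∈ range ⌈(x : ℝ) ^ (1 / u)⌉₊, p.Prime → ¬ ((p : ℤ) ∣ (f 0).coeff 1 * n + (f 0).coeff 0)) =
      (Icc 1 x).filter (fun n : ℕ => ∀ i, 0 < (f i).eval (n : ℤ) ∧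
        ∀ p ∈ range ⌈(x : ℝ) ^ (((f i).natDegree : ℝ) / u)⌉₊,
          p.Prime → ¬ ((p : ℤ) ∣ (f i).eval (n : ℤ))) := by
    refine filter_congr fun n _ => ?_
    rw [Fin.forall_fin_one, hg n, hdeg 0, Nat.cast_one]
  rw [hset, pow_one]

end Summit.Parity.BatemanHorn.Cruxes.RoughValueLaw.IncrementAnchoring
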